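import Mathlib
import Summits.Ventures.PercRepro2.Defs
import Summits.Ventures.PercRepro2.Harris
import Summits.Ventures.PercRepro2.Independence
import Summits.Ventures.PercRepro2.CoinDefs
import Summits.Ventures.PercRepro2.CoinReverse
import Summits.Ventures.PercRepro2.CoinStarDefs
import Summits.Ventures.PercRepro2.CoinLsmCoreDefs
import Summits.Ventures.PercRepro2.CoinLsmCoreU
import Summits.Ventures.PercRepro2.CoinCoreGate
import Summits.Ventures.PercRepro2.CoinTreeCore
import Summits.Ventures.PercRepro2.CoinTreeAncestor
import Summits.Ventures.PercRepro2.CoinOrTailAlg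
import Summits.Ventures.PercRepro2.CoinOrTailDefs
import Summits.Ventures.PercRepro2.CoinOrTailLsmDefs
import Summits.Ventures.PercRepro2.CoinOrTailLsmSums
import Summits.Ventures.PercRepro2.CoinOrTailBlockAlg
import Summits.Ventures.PercRepro2.CoinOrTailBlockSums
import Summits.Ventures.PercRepro2.CoinOrTailMixLsm
import Summits.Ventures.PercRepro2.CoinOrTailCovSums

/-!
# Row 2′DARC at an OR-tail for COVERING markers — one marker above BOTH entries, the other
arbitrary (blind cell PercRepro2, night-2 g10; proofs/NIGHT2-DARC.md §40)

`darc_of_orTailLsmCov`: an OR-tail on a log-supermodular core `U` (`OrTailU`, entries `r, q`,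
tail `a`) and two markers `m₁, m₂ ∈ U` that COVER the entries — every cluster of `U` of positive
probability that contains an entry contains a marker (`hcov`) — give
`Φ_D({s ↛ t in D + (a → w)}) ≥ 0` for the markers `m₁, m₂` at every head.  The dominating form
of §39 (`darc_of_orTailLsmDom`: `r ⟹ m₁`, `q ⟹ m₂`) is the special case where each entry has
its own marker above it; NEW are the placements where ONE marker is a cut vertex above BOTH
entries and the other marker is ANY vertex of the core (`darc_of_orTailTreeCut`) — e.g. the
core `s → m₁ → {r, q} → a` with `m₂` on a side branch that never reaches the tail.
(Under `hν` the cover hypothesis forces each entry to be dominated by a fixed one of the two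
markers — the intersection of two positive clusters is positive — so these are exactly the new
instances.)

The functional is `orTailCov_functional_nonneg` (`CoinOrTailCovSums.lean`: the block theorem
with the two Ahlswede–Daykin steps made unconditional by `CoinOrTailMixLsm.lean`); the
transport through `ClosedInCoreU.phiC_gate_eq`, `OrTailU.sum_R_eq` / `sum_G_eq` and
`OrTailU.head_props` is that of `darc_of_orTailLsm` (§37); the out-tree corollaries use the
ancestor lemma `TreeCore.reach_iterate_par` (`CoinTreeAncestor.lean`).
-/

namespace Summit.Ventures.PercRepro2.Coin

open Classical

section OrTailCovMain

variable {V : Type*} {E : Type*} [Fintype V] [DecidableEq V] [Fintype E] [DecidableEq E]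
  {R : Type*} [Field R] [LinearOrder R] [IsStrictOrderedRing R]
  {arcs : E → Finset (V × V)} {s : V} {U : Finset V} {q a w : V} {cρ cτ : E}

/-- **THEOREM (row 2′DARC at an OR-tail for covering markers).**  `OrTailU arcs s U r q a cρ cτ`
(entries `r, q`), `SameEnds`, the cluster law of `U` log-supermodular (`hν`), markers
`m₁, m₂ ∈ U` covering the entries (`hcov : m₁ ∉ W → m₂ ∉ W → (r ∈ W ∨ q ∈ W) → P(level W) = 0`),
`t, w ∉ U ∪ {a, s}` ⟹ `Φ_D({s ↛ t in D + (a → w)}) ≥ 0` for the markers `m₁, m₂`. -/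
theorem darc_of_orTailLsmCov (pr : E → R) (hp : IsProbVec pr) (hS : SameEnds arcs) {r : V}
    (h : OrTailU arcs s U r q a cρ cτ) {m₁ m₂ : V} (hm₁ : m₁ ∈ U) (hm₂ : m₂ ∈ U)
    (hcov : ∀ W ⊆ U, m₁ ∉ W → m₂ ∉ W → (r ∈ W ∨ q ∈ W) → prob pr (coreLevel arcs s U W) = 0)
    (hν : ∀ W W', W ⊆ U → W' ⊆ U →
      prob pr (coreLevel arcs s U W) * prob pr (coreLevel arcs s U W') ≤
        prob pr (coreLevel arcs s U (W ∩ W')) * prob pr (coreLevel arcs s U (W ∪ W')))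
    {t : V} (htC : t ∉ insert a U) (hts : t ≠ s) (hws : w ≠ s) (hwC : w ∉ insert a U) :
    DARC pr arcs s {t} m₁ m₂ a w := by
  have hC := h.closedInCoreU
  have hm₁a : m₁ ≠ a := fun e => h.a_notin (e ▸ hm₁)
  have hm₂a : m₂ ≠ a := fun e => h.a_notin (e ▸ hm₂)
  have hm₁C : m₁ ∈ insert a U := Finset.mem_insert_of_mem hm₁
  have hm₂C : m₂ ∈ insert a U := Finset.mem_insert_of_mem hm₂
  have haC : a ∈ insert a U := Finset.mem_insert_self _ _
  unfold DARC
  rw [hC.phiC_gate_eq pr hS htC hts hm₁C hm₂C haC hws hwC]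
  have hm1 : ∀ W : Finset V, (fun _ : Finset V => (1 : R)) (insert a W) = (fun _ => (1 : R)) W :=
    fun _ => rfl
  have hmp : ∀ W : Finset V, (fun W : Finset V => if m₁ ∈ W then (1 : R) else 0) (insert a W) =
      (fun W : Finset V => if m₁ ∈ W then (1 : R) else 0) W := by
    intro W; simp only [Finset.mem_insert, hm₁a, false_or]
  have hmq : ∀ W : Finset V, (fun W : Finset V => if m₂ ∈ W then (1 : R) else 0) (insert a W) =
      (fun W : Finset V => if m₂ ∈ W then (1 : R) else 0) W := by
    intro W; simp only [Finset.mem_insert, hm₂a, false_or]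
  have hmpq : ∀ W : Finset V,
      (fun W : Finset V => (if m₁ ∈ W then (1 : R) else 0) * (if m₂ ∈ W then (1 : R) else 0))
        (insert a W) =
      (fun W : Finset V => (if m₁ ∈ W then (1 : R) else 0) * (if m₂ ∈ W then (1 : R) else 0)) W := by
    intro W; simp only [Finset.mem_insert, hm₁a, hm₂a, false_or]
  have eΛ := h.sum_R_eq pr t (fun _ => (1 : R)) hm1
  have eFa := h.sum_R_eq pr t (fun W => if m₁ ∈ W then (1 : R) else 0) hmp
  have eFb := h.sum_R_eq pr t (fun W => if m₂ ∈ W then (1 : R) else 0) hmq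
  have eM := h.sum_G_eq (w := w) pr t (fun _ => (1 : R)) hm1
  have eX := h.sum_G_eq (w := w) pr t (fun W => if m₁ ∈ W then (1 : R) else 0) hmp
  have eY := h.sum_G_eq (w := w) pr t (fun W => if m₂ ∈ W then (1 : R) else 0) hmq
  have eXY := h.sum_G_eq (w := w) pr t
    (fun W => (if m₁ ∈ W then (1 : R) else 0) * (if m₂ ∈ W then (1 : R) else 0)) hmpq
  simp only [mul_one] at eΛ eM
  rw [eΛ, eFa, eFb, eM, eX, eY, eXY]
  obtain ⟨hA0, hAmono, hAlsm⟩ := OrTailU.head_props (U := U) (a := a) pr hp hS t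
  exact orTailCov_functional_nonneg U (fun W => prob pr (coreLevel arcs s U W))
    (fun X => prob pr (coreAvoidEvent arcs s t (insert a U) X)) m₁ m₂ r q a w (pr cρ) (pr cτ)
    h.a_notin (fun hw => hwC (Finset.mem_insert_of_mem hw)) (hp.nonneg cρ) (hp.le_one cρ)
    (hp.nonneg cτ) (hp.le_one cτ) (fun W => prob_nonneg hp _)
    (fun s' hs' t' ht' => hν s' t' hs' ht') hcov hA0 hAlsm hAmono

/-- The ancestors of a vertex `v` in an out-tree core, as a predicate on `m`: `m = par^[i] v`
with the intermediate vertices in the core. -/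
def IsAncestorIn (U : Finset V) (par : V → V) (v m : V) : Prop :=
  ∃ i : ℕ, (∀ k < i, par^[k] v ∈ U) ∧ par^[i] v = m

omit [Fintype V] [Fintype E] [DecidableEq E] in
/-- In an out-tree core, a cluster containing `v` but not an ancestor `m` of `v` (inside the
core) is never a level: the level event is empty. -/
lemma TreeCore.coreLevel_eq_empty_of_ancestor {c : V → E} {par : V → V} {rk : V → ℕ}
    (hT : TreeCore arcs s U c par rk) {v m : V} (hv : v ∈ U) (hm : m ∈ U)
    (hanc : IsAncestorIn U par v m) {W : Finset V} (hvW : v ∈ W) (hmW : m ∉ W) :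
    coreLevel arcs s U W = ∅ := by
  obtain ⟨i, hi, him⟩ := hanc
  ext ω
  simp only [Set.mem_empty_iff_false, iff_false]
  intro hω
  have hr : Reach arcs ω s v := (mem_coreLevel.mp hω v hv).mp hvW
  have hmr : Reach arcs ω s m := him ▸ hT.reach_iterate_par hr i hi
  exact hmW ((mem_coreLevel.mp hω m hm).mpr hmr)

/-- **COROLLARY (an out-tree, each entry below one of the markers).**  `U` an out-tree core
(`TreeCore`), the tail entered at `r, q ∈ U`, markers `m₁, m₂ ∈ U` such that `r` has `m₁` or
`m₂` among its ancestors (or is one of them) and likewise `q`: row 2′DARC at `a → w` for the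
markers `m₁, m₂` at every head. -/
theorem darc_of_orTailTreeCov (pr : E → R) (hp : IsProbVec pr) (hS : SameEnds arcs) {r : V}
    (h : OrTailU arcs s U r q a cρ cτ) {c : V → E} {par : V → V} {rk : V → ℕ}
    (hT : TreeCore arcs s U c par rk) {m₁ m₂ : V} (hm₁ : m₁ ∈ U) (hm₂ : m₂ ∈ U)
    (hr : IsAncestorIn U par r m₁ ∨ IsAncestorIn U par r m₂)
    (hq : IsAncestorIn U par q m₁ ∨ IsAncestorIn U par q m₂)
    {t : V} (htC : t ∉ insert a U) (hts : t ≠ s) (hws : w ≠ s) (hwC : w ∉ insert a U) :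
    DARC pr arcs s {t} m₁ m₂ a w := by
  refine darc_of_orTailLsmCov pr hp hS h hm₁ hm₂ ?_ (hT.coreLevel_lsm pr hp) htC hts hws hwC
  intro W _ hm₁W hm₂W he
  have hempty : coreLevel arcs s U W = ∅ := by
    rcases he with hrW | hqW
    · rcases hr with hanc | hanc
      · exact hT.coreLevel_eq_empty_of_ancestor h.p_mem hm₁ hanc hrW hm₁W
      · exact hT.coreLevel_eq_empty_of_ancestor h.p_mem hm₂ hanc hrW hm₂W
    · rcases hq with hanc | hanc
      · exact hT.coreLevel_eq_empty_of_ancestor h.q_mem hm₁ hanc hqW hm₁W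
      · exact hT.coreLevel_eq_empty_of_ancestor h.q_mem hm₂ hanc hqW hm₂W
  rw [hempty, prob_empty]

/-- **COROLLARY (one marker above BOTH entries, the other arbitrary).**  `U` an out-tree core,
`m₁ = par^[i] r = par^[j] q` a common ancestor of the two entries (a cut vertex between `s` and
the tail), `m₂` ANY vertex of `U`: row 2′DARC at `a → w` for the markers `m₁, m₂` at every head.
E.g. `s → m₁ → r → a`, `m₁ → q → a` with `m₂` on a side branch `s → m₂` that never reaches the
tail, or `m₂` one of the entries. -/
theorem darc_of_orTailTreeCut (pr : E → R) (hp : IsProbVec pr) (hS : SameEnds arcs) {r : V}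
    (h : OrTailU arcs s U r q a cρ cτ) {c : V → E} {par : V → V} {rk : V → ℕ}
    (hT : TreeCore arcs s U c par rk) {m₁ m₂ : V} (hm₁ : m₁ ∈ U) (hm₂ : m₂ ∈ U)
    {i : ℕ} (hi : ∀ k < i, par^[k] r ∈ U) (hir : par^[i] r = m₁)
    {j : ℕ} (hj : ∀ k < j, par^[k] q ∈ U) (hjq : par^[j] q = m₁)
    {t : V} (htC : t ∉ insert a U) (hts : t ≠ s) (hws : w ≠ s) (hwC : w ∉ insert a U) :
    DARC pr arcs s {t} m₁ m₂ a w :=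
  darc_of_orTailTreeCov pr hp hS h hT hm₁ hm₂ (Or.inl ⟨i, hi, hir⟩) (Or.inl ⟨j, hj, hjq⟩)
    htC hts hws hwC

end OrTailCovMain

end Summit.Ventures.PercRepro2.Coin
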